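import Literature.MathematicalPhysics.QuantumFieldTheory.Balaban1983to89.B9Thm37GlueTorusCov

/-!
# `Balaban1983to89.B9Thm37GlueTorusCovComp` — COMPOSITION of covariant block means: the j-step
# averaging Q′_j(U) = Q′(Ū^{j−1})·…·Q′(Ū)Q′(U) of (3.15)/(3.19) is again a one-step-SHAPED covariant mean
# (composed blocks, product weights, PRODUCT transports = the composite contour variables), reproduction of
# covariantly constant fields propagates through the composition, and Δ_U + a·(Q₂Q₁)ᵀ(Q₂Q₁) is STRICTLY
# POSITIVE for EVERY unit transport (MODEL; own lineage pv21; imports `B9Thm37GlueTorusCov` only; modifies nothing)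

References (bib keys; the tags below cite only these):
* [B9] = `Balaban1985BackgroundPropagators` — T. Bałaban, *Propagators for lattice gauge theories in a background
  field*, Commun. Math. Phys. 99 (1985) 389–434.
* [B7] = `Balaban1985Averaging` — T. Bałaban, *Averaging operations for lattice gauge theories*, Commun. Math. Phys.
  98 (1985) 17–51 (= reference [5] of [B9]).

THE PRINTED LOCI (read as images of the printed pages; two NEW spans, everything else only NAMED).
(a) [B9] p. 393, before (3.15): «We are interested in the linear operators Q_j(U). They are compositions of j
one-step averaging operators» — display (3.15): Q_j(U) = Q(Ū^{j−1})·…·Q(Ū)Q(U) — «where Q(V) is given by the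
explicit formula (124) in [5].»  The linearised (algebra-valued) counterpart is (3.18)–(3.19) p. 393, certified
VERBATIM in the header of `B9Thm37GlueTorusCov` (not re-quoted here): Q′_j(U) = Q′(Ū^{j−1})·…·Q′(Ū)Q′(U) =
Σ_{x∈B^j(y)} L^{−jd} R(U(Γ^{(j)}_{y,x}))·, with the one-step operator (Q′(V)λ)(y) = Σ_{x∈B(y)} L^{−d} R(V(Γ_{y,x}))λ(x)
and the pointer to "(52), (53) in [5]" for the contours Γ^{(j)}_{y,x} and the contour variables U(Γ^{(j)}_{y,x}).
(b) [B7] p. 29, the lines after display (76) (the published form of the composite contour variables):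
«Let us denote U₀(Γ^{(j)}_{x_j,x}) = Ū₀^{j−1}(Γ_{x_j,x_{j−1}})·…·Ū₀(Γ_{x₂,x₁})U₀(Γ_{x₁,x}),» (print spaces
the central dots as "· ... ·"; rendered "·…·" here, nothing else differs) i.e. the composite contour variable
from the j-th-level point x_j down to the fine point x is the ORDERED PRODUCT of the one-step contour variables of
the successive (averaged) configurations Ū₀^{j−1}, …, Ū₀, U₀ along the chain of base points x_j → x_{j−1} → ⋯ →
x₁ → x.  (Numbering note, nothing inferred from it: in the published [B7] the displays (52)–(53),
p. 26, are the plaquette smallness condition |U(∂p) − 1| < α₀η² and the inductive bound on Ū^j(∂p), so the pointer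
"(52), (53) in [5]" of [B9] does not match the published numbering of [B7].)  NOTHING printed is asserted as a
theorem — every declaration below is a MODEL definition or a kernel-checked theorem about the component model of the
lineage (`B9Thm37Glue.covD`, `B9Thm37GlueTorusCov.Comb`, `…covMean`).

THE POINT (value = a MODEL kernel certificate steering the lineage; NOT summit progress).  `B9Thm37GlueTorusCov`
modelled only the ONE-STEP covariant mean Q′(V) and proved Δ_U + a·Q_UᵀQ_U strictly positive for every isometric
transport; its honest scope excluded "the multi-step Q′_j(U) of (3.19) (compositions through the averaged
configurations Ū^j)".  THIS FILE supplies the ALGEBRA of the composition and carries the positivity through it: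
 * §1 component matrices: the product `mmul P Q` ((PQ)_{ij} = Σ_k P_{ik}Q_{kj}), products of isometries are
   isometries (`mmul_orth`), an isometry annihilates only 0 (`eq_zero_of_orth_apply_eq_zero`), and REPRODUCTION
   COMPOSES (`mmul_reproduces`: if Q carries u to v and P carries v to w then PQ carries u to w).
 * §2 the GENERAL covariant block mean `gMean blk W T = bsum blk 1 ∘ trOp (W·T)`:
   (G f)(β, i) = Σ_{x : blk x = β} W(x)·Σ_j T(x)_{ij} f(x, j) for an arbitrary blocking map `blk : St → B`, site weights
   W and site transports T (`gMean_apply`); the comb mean of `B9Thm37GlueTorusCov` is the case W = w ∘ blk,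
   T = K.tr Rm (`covMean_eq_gMean`, `covMeanT_eq_gMeanT`); its explicit transpose `gMeanT` (`isTransposePair_gMean`).
   THE COMPOSITION THEOREM `gMean_comp` (the model of the second equality of (3.19), i.e. of (3.15) composed out):
       gMean blk₂ W₂ T₂ ∘ gMean blk₁ W₁ T₁ = gMean (blk₂ ∘ blk₁) (W₂∘blk₁ · W₁) (x ↦ T₂(blk₁ x)·T₁(x))
   — blocks compose (B^j), weights multiply (L^{−d}·…·L^{−d} = L^{−jd}), and the transport of the composite is the
   ORDERED PRODUCT of the coarse transport at the block of x with the fine transport at x, exactly the structure of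
   locus (b).  It rests on three commutation identities of the `B9Thm37GlueTorusCov` operators: `trOp_comp`
   (trOp P ∘ trOp Q = trOp (PQ)), `trOp_comp_bsum` (a coarse transport passes through a block sum as the
   block-constant fine transport P ∘ blk) and `bsum_one_comp_bsum_one` (block sums compose).  `gMean_comp₃` shows the
   step iterates (three levels; j levels by repeating the rewrite).
 * §3 POSITIVITY IN GENERAL: if the transports REPRODUCE every covariantly constant field from block-constant base
   values (hypothesis `hrep`: ∇_U f = 0 ⇒ Σ_j T(x)_{ij} f(x, j) = f(base(blk x), i)), are isometries, and the site
   weights are > 0, then f ≠ 0, ∇_U f = 0 ⇒ G f ≠ 0 (`gMean_ne_zero`: the mean over the block of a site where f ≠ 0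
   is (Σ_{block} W)·f(base) ≠ 0), hence `gLapCov … a = D\*D + a·GᵀG` has quadratic form Σ(∇_U f)² + a·Σ(Gf)²
   (`qform_gLapCov`), is symmetric (`isTransposePair_gLapCov`), STRICTLY POSITIVE for a > 0 (`posDef_gLapCov`) and a
   unit with a genuine two-sided `Ring.inverse` (`isUnit_gLapCov`, `inverse_mul_gLapCov`, `mul_inverse_gLapCov`);
   `covLapCov_eq_gLapCov` recovers the one-step operator of `B9Thm37GlueTorusCov` as the special case.
 * §4 TWO NESTED COMBS (the model of Q′(Ū)Q′(U)): for a fine comb K₁ (small blocks B₁) and a big comb K (blocks B)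
   over the SAME bond structure, the coarse mean `coarseMean K₁ K Rm W₂` on B₁ × Cp has block label = the K-block of
   the K₁-base point and transport = K's holonomy `K.tr Rm (K₁.base β)` to that base point; `coarseMean_comp_covMean`
   is the composite formula, `twoLevel_reproduces` the propagated reproduction (by `Comb.tr_reproduces` twice and
   `mmul_reproduces`), `twoLevel_orth` the isometry, `transpose_comp_eq_gMeanT` the transposed composite (by
   uniqueness of transposes), and `posDef_twoLevelOp` / `isUnit_twoLevelOp`: Δ_U + a·(Q₂Q₁)ᵀ(Q₂Q₁) is strictly
   positive and a unit for EVERY isometric transport, all bond weights ≠ 0, all block weights > 0, a > 0 — with NO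
   nesting, flatness or regularity hypothesis.
 * §5 TORUS: for cube blockings of sides M₀ ∣ M on the lineage's torus `UT N` the composite blocking IS the M-cube
   blocking (`tblk_ctrU_tblk`, `torusComb_twoLevel_blk`: the M-block of the M₀-corner of x is the M-block of x), and
   the two-level operator of the lexicographic combs `torusComb` is a unit for every isometric transport
   (`isUnit_twoLevelOp_torus`).
 * §6 TWINS: at a = 0 the operator is the bare Δ_U and is NOT a unit for the trivial transport (constants in the
   kernel; `not_isUnit_twoLevelOp_zero` — the hypothesis a > 0 is used), and on the 8-point circle with the flat
   quarter-turn transport `Rm8` of `B9Thm37GlueTorusTwist` (two 4-blocks under one 8-block, `comb8`/`comb8c`,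
   nesting `comb8_twoLevel_blk`) the two-level operator IS a unit (`isUnit_twoLevel_twist8`), next to
   `not_isUnit_twist8` for the U-independent mean.

NOT ASSERTED, NOT MODELLED (honest scope).  (i) The averaged configurations Ū, Ū², … of [B7] (42)–(43) are NOT
constructed: print's coarse one-step operators Q′(Ū^i) transport with R(Ū^i(Γ)), products of the NONLINEARLY
AVERAGED bond variables over coarse bonds, whereas the coarse transports of §4 are holonomies of U ITSELF along the
big comb's fine path to the small base point (in general NOT the product of the small comb paths, and not an average
over parallel paths); §2–§3 therefore take the coarse transports as free DATA (`T₂`, hypothesis `hrep`) and §4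
discharges `hrep` only for comb holonomies — this is why no "regularity of the configuration U" (p. 395) is needed
here, while print needs it.  (ii) Only the algebraic identity (3.15)/(3.19) and qualitative positivity: no
(3.16)–(3.17), no scale weights (L^jη)^{d−2}, no sum over the levels j = 0, …, k of (3.16) (one composite term with
a free parameter a > 0), no Dirichlet data on Ω₀ᶜ, no coercivity constant, no decay, no uniformity in U beyond
"isometric", nothing of Theorems 3.1–3.3, Corollary 3.6 or Theorem 3.7 of [B9].  (iii) The capstones of the chain
(`B9Thm37GlueTorusInv`, `…TorusRW`, `…TorusScaled`) are wired to the DIAGONAL mass and do not consume `gLapCov`.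
Value = MODEL kernel certificate, NOT summit progress; NOT continuum, NOT Clay, NOT a claim about print beyond the
two quoted spans.
-/

namespace Literature.MathematicalPhysics.QuantumFieldTheory.Balaban1983to89.B9Thm37GlueTorusCovComp

open Finset B9Thm37Sum B9Thm37Glue B9Thm37GluePU B9Thm37GlueTorusInv B9Thm37GlueTorusTwist B9Thm37GlueTorusCov
open B5TorusCover (UT Ctr ctrU ctr nC)
open B5Leibniz121 (up dn up_dn)

/-! ## §1  Component matrices: products, isometries, reproduction -/

section Matrices

variable {Cp : Type} [Fintype Cp]

/-- MODEL bookkeeping: the product of two component matrices, (PQ)_{ij} = Σ_k P_{ik}Q_{kj} (the model of the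
ordered product of contour variables in locus (b)). [cite: Balaban1985Averaging, p.29] -/
def mmul (P Q : Cp → Cp → ℝ) : Cp → Cp → ℝ := fun i j => ∑ k, P i k * Q k j

/-- Unfolding of `mmul`. [folklore] -/
theorem mmul_apply (P Q : Cp → Cp → ℝ) (i j : Cp) : mmul P Q i j = ∑ k, P i k * Q k j := rfl

/-- **A product of isometries is an isometry** (columns orthonormal). [folklore] -/
theorem mmul_orth [DecidableEq Cp] {P Q : Cp → Cp → ℝ}
    (hP : ∀ i j, ∑ k, P k i * P k j = if i = j then (1 : ℝ) else 0)
    (hQ : ∀ i j, ∑ k, Q k i * Q k j = if i = j then (1 : ℝ) else 0) :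
    ∀ i j, ∑ k, mmul P Q k i * mmul P Q k j = if i = j then (1 : ℝ) else 0 := by
  intro i j
  have h1 : ∀ k, mmul P Q k i * mmul P Q k j = ∑ a, ∑ b, P k a * P k b * (Q a i * Q b j) := fun k => by
    rw [mmul_apply, mmul_apply, Finset.sum_mul_sum]
    exact Finset.sum_congr rfl fun a _ => Finset.sum_congr rfl fun b _ => by ring
  calc ∑ k, mmul P Q k i * mmul P Q k j = ∑ k, ∑ a, ∑ b, P k a * P k b * (Q a i * Q b j) :=
        Finset.sum_congr rfl fun k _ => h1 k
    _ = ∑ a, ∑ b, ∑ k, P k a * P k b * (Q a i * Q b j) := by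
        rw [Finset.sum_comm]
        exact Finset.sum_congr rfl fun a _ => Finset.sum_comm
    _ = ∑ a, ∑ b, (if a = b then (1 : ℝ) else 0) * (Q a i * Q b j) := by
        refine Finset.sum_congr rfl fun a _ => Finset.sum_congr rfl fun b _ => ?_
        rw [← Finset.sum_mul, hP a b]
    _ = ∑ a, Q a i * Q a j := by
        refine Finset.sum_congr rfl fun a _ => ?_
        rw [Finset.sum_eq_single a (fun b _ hb => by rw [if_neg (Ne.symm hb), zero_mul])
          (fun h => absurd (mem_univ a) h), if_pos rfl, one_mul]
    _ = if i = j then (1 : ℝ) else 0 := hQ i j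

/-- **An isometry annihilates only the zero vector.** [folklore] -/
theorem eq_zero_of_orth_apply_eq_zero [DecidableEq Cp] {P : Cp → Cp → ℝ}
    (hP : ∀ i j, ∑ k, P k i * P k j = if i = j then (1 : ℝ) else 0) (v : Cp → ℝ)
    (hv : ∀ i, ∑ j, P i j * v j = 0) : v = 0 := by
  funext j'
  calc v j' = ∑ j, (if j' = j then (1 : ℝ) else 0) * v j := by
          rw [Finset.sum_eq_single j' (fun j _ hj => by rw [if_neg (Ne.symm hj), zero_mul])
            (fun h => absurd (mem_univ j') h), if_pos rfl, one_mul]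
    _ = ∑ j, (∑ i, P i j' * P i j) * v j := by simp_rw [hP]
    _ = ∑ i, P i j' * ∑ j, P i j * v j := by
          simp_rw [Finset.sum_mul, Finset.mul_sum]
          rw [Finset.sum_comm]
          exact Finset.sum_congr rfl fun i _ => Finset.sum_congr rfl fun j _ => by ring
    _ = 0 := by simp_rw [hv, mul_zero, Finset.sum_const_zero]
    _ = (0 : Cp → ℝ) j' := rfl

/-- **Reproduction composes**: if Q carries u to v (Σ_j Q_{ij}u_j = v_i) and P carries v to w, then the product PQ
carries u to w — the algebra behind locus (b). [folklore] -/
theorem mmul_reproduces {P Q : Cp → Cp → ℝ} {u v w : Cp → ℝ}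
    (hQ : ∀ i, ∑ j, Q i j * u j = v i) (hP : ∀ i, ∑ j, P i j * v j = w i) :
    ∀ i, ∑ j, mmul P Q i j * u j = w i := by
  intro i
  calc ∑ j, mmul P Q i j * u j = ∑ j, ∑ k, P i k * Q k j * u j := by
        simp only [mmul_apply, Finset.sum_mul]
    _ = ∑ k, P i k * ∑ j, Q k j * u j := by
        rw [Finset.sum_comm]
        simp only [Finset.mul_sum]
        exact Finset.sum_congr rfl fun k _ => Finset.sum_congr rfl fun j _ => by ring
    _ = w i := by simp_rw [hQ]; exact hP i

end Matrices

/-! ## §2  The general covariant block mean and THE COMPOSITION THEOREM -/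

section Operators

variable {St Bd B B₁ B₂ B₃ Cp : Type}

/-- **Pointwise transports compose**: trOp P ∘ trOp Q = trOp (PQ). [folklore] -/
theorem trOp_comp [Fintype Cp] (P Q : St → Cp → Cp → ℝ) :
    trOp P ∘ₗ trOp Q = trOp (fun x => mmul (P x) (Q x)) := by
  apply LinearMap.ext
  intro f
  funext p
  simp only [LinearMap.comp_apply, trOp_apply, mmul_apply, Finset.mul_sum, Finset.sum_mul]
  rw [Finset.sum_comm]
  exact Finset.sum_congr rfl fun k _ => Finset.sum_congr rfl fun j _ => by ring

/-- **A coarse transport passes through a block sum** as the block-constant fine transport P ∘ blk: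
trOp P ∘ bsum blk w = bsum blk w ∘ trOp (P ∘ blk). [folklore] -/
theorem trOp_comp_bsum [Fintype St] [DecidableEq B] [Fintype Cp] (P : B → Cp → Cp → ℝ) (blk : St → B)
    (w : B → ℝ) : trOp P ∘ₗ bsum blk w = bsum blk w ∘ₗ trOp (Cp := Cp) (fun x => P (blk x)) := by
  apply LinearMap.ext
  intro g
  funext q
  simp only [LinearMap.comp_apply, trOp_apply, bsum_apply]
  calc ∑ k, P q.1 q.2 k * (w q.1 * ∑ x, if blk x = q.1 then g (x, k) else 0)
      = w q.1 * ∑ k, ∑ x, (if blk x = q.1 then P q.1 q.2 k * g (x, k) else 0) := by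
          rw [Finset.mul_sum]
          refine Finset.sum_congr rfl fun k _ => ?_
          rw [Finset.mul_sum, Finset.mul_sum, Finset.mul_sum]
          refine Finset.sum_congr rfl fun x _ => ?_
          split_ifs <;> ring
    _ = w q.1 * ∑ x, ∑ k, (if blk x = q.1 then P q.1 q.2 k * g (x, k) else 0) := by rw [Finset.sum_comm]
    _ = w q.1 * ∑ x, if blk x = q.1 then ∑ k, P (blk x) q.2 k * g (x, k) else 0 := by
          congr 1
          refine Finset.sum_congr rfl fun x _ => ?_
          split_ifs with h
          · rw [h]
          · exact Finset.sum_const_zero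

/-- **Block sums compose**: summing over small blocks and then over the small blocks of a big block is summing over
the big block (unit weights). [folklore] -/
theorem bsum_one_comp_bsum_one [Fintype St] [Fintype B₁] [DecidableEq B₁] [DecidableEq B₂] (blk₁ : St → B₁)
    (blk₂ : B₁ → B₂) :
    bsum blk₂ (fun _ => (1 : ℝ)) ∘ₗ bsum blk₁ (fun _ => (1 : ℝ)) = bsum (Cp := Cp) (blk₂ ∘ blk₁) (fun _ => 1) := by
  apply LinearMap.ext
  intro g
  funext q
  simp only [LinearMap.comp_apply, bsum_apply, one_mul, Function.comp]
  symm
  calc ∑ x, (if blk₂ (blk₁ x) = q.1 then g (x, q.2) else 0)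
      = ∑ x, ∑ β, (if blk₁ x = β then (if blk₂ β = q.1 then g (x, q.2) else 0) else 0) := by
          refine Finset.sum_congr rfl fun x _ => ?_
          rw [Finset.sum_ite_eq, if_pos (mem_univ _)]
    _ = ∑ β, ∑ x, (if blk₁ x = β then (if blk₂ β = q.1 then g (x, q.2) else 0) else 0) := Finset.sum_comm
    _ = ∑ β, (if blk₂ β = q.1 then ∑ x, (if blk₁ x = β then g (x, q.2) else 0) else 0) := by
          refine Finset.sum_congr rfl fun β _ => ?_
          split_ifs with h
          · rfl
          · exact Finset.sum_eq_zero fun x _ => by split_ifs <;> rfl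

/-- **The general covariant block mean** (MODEL of the SHAPE shared by Q′(V) and by every composite Q′_j(U) in
(3.19)): for a blocking map `blk : St → B`, site weights `W` and site transports `T`,
(G f)(β, i) = Σ_{x : blk x = β} W(x)·Σ_j T(x)_{ij} f(x, j) — transport, weight, sum over the block.
[cite: Balaban1985BackgroundPropagators, (3.19) p.393] -/
def gMean [Fintype St] [DecidableEq B] [Fintype Cp] (blk : St → B) (W : St → ℝ) (T : St → Cp → Cp → ℝ) :
    (St × Cp → ℝ) →ₗ[ℝ] (B × Cp → ℝ) :=
  bsum blk (fun _ => 1) ∘ₗ trOp (fun x i j => W x * T x i j)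

/-- MODEL: the explicit transpose of the general covariant block mean. [cite: Balaban1985BackgroundPropagators, (3.19) p.393 + p.391] -/
def gMeanT [Fintype Cp] (blk : St → B) (W : St → ℝ) (T : St → Cp → Cp → ℝ) :
    (B × Cp → ℝ) →ₗ[ℝ] (St × Cp → ℝ) :=
  trOpT (fun x i j => W x * T x i j) ∘ₗ bsumT blk (fun _ => 1)

/-- Unfolding of `gMean`. [folklore] -/
theorem gMean_apply [Fintype St] [DecidableEq B] [Fintype Cp] (blk : St → B) (W : St → ℝ)
    (T : St → Cp → Cp → ℝ) (f : St × Cp → ℝ) (q : B × Cp) :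
    gMean blk W T f q = ∑ x, if blk x = q.1 then W x * ∑ j, T x q.2 j * f (x, j) else 0 := by
  simp only [gMean, LinearMap.comp_apply, bsum_apply, trOp_apply, one_mul]
  refine Finset.sum_congr rfl fun x _ => ?_
  split_ifs
  · rw [Finset.mul_sum]
    exact Finset.sum_congr rfl fun j _ => by ring
  · rfl

/-- Unfolding of `gMeanT`. [folklore] -/
theorem gMeanT_apply [Fintype Cp] (blk : St → B) (W : St → ℝ) (T : St → Cp → Cp → ℝ) (h : B × Cp → ℝ)
    (p : St × Cp) : gMeanT blk W T h p = W p.1 * ∑ i, T p.1 i p.2 * h (blk p.1, i) := by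
  simp only [gMeanT, LinearMap.comp_apply, trOpT_apply, bsumT_apply, one_mul]
  rw [Finset.mul_sum]
  exact Finset.sum_congr rfl fun i _ => by ring

/-- `gMeanT` is the transpose of `gMean` for the component pairings. [folklore] -/
theorem isTransposePair_gMean [Fintype St] [Fintype B] [DecidableEq B] [Fintype Cp] (blk : St → B) (W : St → ℝ)
    (T : St → Cp → Cp → ℝ) : IsTransposePair (gMean blk W T) (gMeanT blk W T) :=
  (isTransposePair_trOp _).comp (isTransposePair_bsum blk _)

variable {src tgt : Bd → St}

/-- **The comb mean of `B9Thm37GlueTorusCov` is a general covariant block mean** with block-constant weights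
W = w ∘ blk and the comb transports T = K.tr Rm. [folklore] -/
theorem covMean_eq_gMean [Fintype St] [DecidableEq B] [Fintype Cp] [DecidableEq Cp] (K : Comb src tgt B)
    (w : B → ℝ) (Rm : Bd → Cp → Cp → ℝ) :
    covMean K w Rm = gMean K.blk (fun x => w (K.blk x)) (K.tr Rm) := by
  apply LinearMap.ext
  intro f
  funext q
  rw [covMean_apply, gMean_apply, Finset.mul_sum]
  refine Finset.sum_congr rfl fun x _ => ?_
  split_ifs with h
  · rw [h]
  · rw [mul_zero]

/-- The same for the transposes. [folklore] -/
theorem covMeanT_eq_gMeanT [Fintype Cp] [DecidableEq Cp] (K : Comb src tgt B) (w : B → ℝ)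
    (Rm : Bd → Cp → Cp → ℝ) : covMeanT K w Rm = gMeanT K.blk (fun x => w (K.blk x)) (K.tr Rm) := by
  apply LinearMap.ext
  intro h
  funext p
  rw [covMeanT_apply, gMeanT_apply, Finset.mul_sum]
  exact Finset.sum_congr rfl fun i _ => by ring

/-- **THE COMPOSITION THEOREM** (MODEL of (3.15) and of the second equality of (3.19)): the composition of two
general covariant block means is the general covariant block mean with COMPOSED blocks blk₂ ∘ blk₁, PRODUCT weights
W₂(blk₁ x)·W₁(x) (L^{−d}·L^{−d} = L^{−2d}) and PRODUCT transports T₂(blk₁ x)·T₁(x) — the coarse transport at the block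
of x after the fine transport at x, the structure of the composite contour variables of locus (b).
[cite: Balaban1985BackgroundPropagators, (3.15)+(3.19) p.393; Balaban1985Averaging, p.29] -/
theorem gMean_comp [Fintype St] [Fintype B₁] [DecidableEq B₁] [DecidableEq B₂] [Fintype Cp] (blk₁ : St → B₁)
    (W₁ : St → ℝ) (T₁ : St → Cp → Cp → ℝ) (blk₂ : B₁ → B₂) (W₂ : B₁ → ℝ) (T₂ : B₁ → Cp → Cp → ℝ) :
    gMean blk₂ W₂ T₂ ∘ₗ gMean blk₁ W₁ T₁ =
      gMean (blk₂ ∘ blk₁) (fun x => W₂ (blk₁ x) * W₁ x) (fun x => mmul (T₂ (blk₁ x)) (T₁ x)) := by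
  have hT : (fun x i j => (W₂ (blk₁ x) * W₁ x) * mmul (T₂ (blk₁ x)) (T₁ x) i j)
      = fun x => mmul (fun i j => W₂ (blk₁ x) * T₂ (blk₁ x) i j) (fun i j => W₁ x * T₁ x i j) := by
    funext x i j
    simp only [mmul_apply, Finset.mul_sum]
    exact Finset.sum_congr rfl fun k _ => by ring
  calc gMean blk₂ W₂ T₂ ∘ₗ gMean blk₁ W₁ T₁
      = bsum blk₂ (fun _ => 1) ∘ₗ ((trOp (fun β i j => W₂ β * T₂ β i j) ∘ₗ bsum blk₁ (fun _ => 1)) ∘ₗ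
          trOp (fun x i j => W₁ x * T₁ x i j)) := by
            simp only [gMean, LinearMap.comp_assoc]
    _ = bsum blk₂ (fun _ => 1) ∘ₗ ((bsum blk₁ (fun _ => 1) ∘ₗ
          trOp (fun x => (fun β i j => W₂ β * T₂ β i j) (blk₁ x))) ∘ₗ trOp (fun x i j => W₁ x * T₁ x i j)) := by
            rw [trOp_comp_bsum]
    _ = (bsum blk₂ (fun _ => 1) ∘ₗ bsum blk₁ (fun _ => 1)) ∘ₗ
          (trOp (fun x i j => W₂ (blk₁ x) * T₂ (blk₁ x) i j) ∘ₗ trOp (fun x i j => W₁ x * T₁ x i j)) := by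
            simp only [LinearMap.comp_assoc]
    _ = gMean (blk₂ ∘ blk₁) (fun x => W₂ (blk₁ x) * W₁ x) (fun x => mmul (T₂ (blk₁ x)) (T₁ x)) := by
            rw [bsum_one_comp_bsum_one, trOp_comp]
            exact congrArg (fun F => bsum (blk₂ ∘ blk₁) (fun _ => (1 : ℝ)) ∘ₗ trOp F) hT.symm

/-- **The step iterates** (three levels; j levels by repeating the rewrite): blocks compose, weights multiply
(L^{−3d}), transports multiply in order T₃·T₂·T₁. [cite: Balaban1985BackgroundPropagators, (3.15)+(3.19) p.393] -/
theorem gMean_comp₃ [Fintype St] [Fintype B₁] [DecidableEq B₁] [Fintype B₂] [DecidableEq B₂] [DecidableEq B₃]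
    [Fintype Cp] (blk₁ : St → B₁) (W₁ : St → ℝ) (T₁ : St → Cp → Cp → ℝ) (blk₂ : B₁ → B₂) (W₂ : B₁ → ℝ)
    (T₂ : B₁ → Cp → Cp → ℝ) (blk₃ : B₂ → B₃) (W₃ : B₂ → ℝ) (T₃ : B₂ → Cp → Cp → ℝ) :
    gMean blk₃ W₃ T₃ ∘ₗ (gMean blk₂ W₂ T₂ ∘ₗ gMean blk₁ W₁ T₁) =
      gMean (blk₃ ∘ blk₂ ∘ blk₁) (fun x => W₃ (blk₂ (blk₁ x)) * (W₂ (blk₁ x) * W₁ x))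
        (fun x => mmul (T₃ (blk₂ (blk₁ x))) (mmul (T₂ (blk₁ x)) (T₁ x))) := by
  rw [gMean_comp blk₁ W₁ T₁ blk₂ W₂ T₂, gMean_comp]
  rfl

end Operators

/-! ## §3  Positivity of Δ_U + a·GᵀG for a reproducing, isometric, positively weighted mean -/

section Positivity

variable {St Bd B Cp : Type} [Fintype St] [DecidableEq B] [Fintype Cp]

/-- **On a field reproduced from block-constant base values the general mean reads off those values**:
(G f)(β, i) = (Σ_{x : blk x = β} W(x))·f(base β, i). [folklore] -/
theorem gMean_apply_of_reproduces (blk : St → B) (W : St → ℝ) (T : St → Cp → Cp → ℝ) (base : B → St)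
    {f : St × Cp → ℝ} (hrep : ∀ x i, ∑ j, T x i j * f (x, j) = f (base (blk x), i)) (β : B) (i : Cp) :
    gMean blk W T f (β, i) = (∑ x ∈ univ.filter (fun x => blk x = β), W x) * f (base β, i) := by
  rw [gMean_apply, ← Finset.sum_filter, Finset.sum_mul]
  refine Finset.sum_congr rfl fun x hx => ?_
  rw [hrep x i, (mem_filter.mp hx).2]

/-- **THE MECHANISM (general form).** A non-zero field reproduced by ISOMETRIC transports from block-constant base
values has NON-ZERO general mean when all site weights are > 0: transported back, its base value at the block of
a site where it does not vanish is non-zero, and the mean there is (Σ_{block} W)·(that value). [folklore] -/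
theorem gMean_ne_zero [DecidableEq Cp] (blk : St → B) {W : St → ℝ} (hW : ∀ x, 0 < W x) {T : St → Cp → Cp → ℝ}
    (hT : ∀ x i j, ∑ k, T x k i * T x k j = if i = j then (1 : ℝ) else 0) (base : B → St)
    {f : St × Cp → ℝ} (hf : f ≠ 0) (hrep : ∀ x i, ∑ j, T x i j * f (x, j) = f (base (blk x), i)) :
    gMean blk W T f ≠ 0 := by
  obtain ⟨⟨x₀, i₁⟩, hx₀⟩ := Function.ne_iff.mp hf
  have hv : ∃ i₀, f (base (blk x₀), i₀) ≠ 0 := by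
    by_contra hall
    simp only [not_exists, not_not] at hall
    have hzero := eq_zero_of_orth_apply_eq_zero (hT x₀) (fun j => f (x₀, j))
      (fun i => by rw [hrep x₀ i]; exact hall i)
    exact hx₀ (by simpa using congrFun hzero i₁)
  obtain ⟨i₀, hi₀⟩ := hv
  intro hG
  have h := congrFun hG (blk x₀, i₀)
  rw [gMean_apply_of_reproduces blk W T base hrep, Pi.zero_apply] at h
  have hpos : 0 < ∑ x ∈ univ.filter (fun x => blk x = blk x₀), W x :=
    Finset.sum_pos (fun x _ => hW x) ⟨x₀, mem_filter.mpr ⟨mem_univ _, rfl⟩⟩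
  exact mul_ne_zero hpos.ne' hi₀ h

variable [DecidableEq St] [Fintype Bd] (src tgt : Bd → St) (c : Bd → ℝ) (Rm : Bd → Cp → Cp → ℝ)
  (blk : St → B) (W : St → ℝ) (T : St → Cp → Cp → ℝ)

/-- **The model of Δ_U + a·GᵀG for a general covariant block mean G**: `gLapCov … a = D\*D + a·GᵀG` with D = `covD`,
D\* = `covDT` of `B9Thm37Glue`. [cite: Balaban1985BackgroundPropagators, (3.23)–(3.24) p.394 + (3.19) p.393] -/
def gLapCov (a : ℝ) : Module.End ℝ (St × Cp → ℝ) :=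
  covDT src tgt c Rm ∘ₗ covD src tgt c Rm + a • (gMeanT blk W T ∘ₗ gMean blk W T)

/-- **The one-step operator of `B9Thm37GlueTorusCov` is the special case** W = w ∘ blk, T = K.tr Rm. [folklore] -/
theorem covLapCov_eq_gLapCov [DecidableEq Cp] (K : Comb src tgt B) (w : B → ℝ) (a : ℝ) :
    covLapCov K c w Rm a = gLapCov src tgt c Rm K.blk (fun x => w (K.blk x)) (K.tr Rm) a := by
  rw [covLapCov, gLapCov, covMean_eq_gMean, covMeanT_eq_gMeanT]

variable [Fintype B]

/-- **Δ_U + a·GᵀG is symmetric** for the component pairing. [folklore] -/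
theorem isTransposePair_gLapCov (a : ℝ) :
    IsTransposePair (gLapCov src tgt c Rm blk W T a) (gLapCov src tgt c Rm blk W T a) :=
  (isTransposePair_covLap src tgt c Rm).add
    (isTransposePair_smul ((isTransposePair_gMean blk W T).comp (isTransposePair_gMean blk W T).symm) a)

/-- **The quadratic form of Δ_U + a·GᵀG**: Σ_p f(p)((D\*D + a·GᵀG)f)(p) = Σ_b (Df)(b)² + a·Σ_q (Gf)(q)².
[cite: Balaban1985BackgroundPropagators, (3.23)–(3.24) p.394] -/
theorem qform_gLapCov (a : ℝ) (f : St × Cp → ℝ) :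
    ∑ p, f p * gLapCov src tgt c Rm blk W T a f p =
      ∑ b, covD src tgt c Rm f b * covD src tgt c Rm f b + a * ∑ q, gMean blk W T f q * gMean blk W T f q := by
  rw [isTransposePair_covD src tgt c Rm f (covD src tgt c Rm f),
    isTransposePair_gMean blk W T f (gMean blk W T f), Finset.mul_sum, ← Finset.sum_add_distrib]
  refine Finset.sum_congr rfl fun p _ => ?_
  simp only [gLapCov, LinearMap.add_apply, Pi.add_apply, LinearMap.comp_apply, LinearMap.smul_apply,
    Pi.smul_apply, smul_eq_mul]
  ring

/-- **MAIN ABSTRACT THEOREM (MODEL). Δ_U + a·GᵀG is STRICTLY POSITIVE** whenever the transports of G are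
isometries reproducing every covariantly constant field from block-constant base values (`hrep`), the site weights
are > 0 and a > 0: Σ_p f(p)((Δ_U + a·GᵀG)f)(p) > 0 for f ≠ 0 — for EVERY bond transport Rm, no flatness, nesting or
regularity hypothesis. [cite: Balaban1985BackgroundPropagators, p.395 + (3.23)–(3.24) p.394 + (3.19) p.393] -/
theorem posDef_gLapCov [DecidableEq Cp] (hW : ∀ x, 0 < W x) (hT : ∀ x i j, ∑ k, T x k i * T x k j = if i = j then (1 : ℝ) else 0)
    (base : B → St)
    (hrep : ∀ f : St × Cp → ℝ, covD src tgt c Rm f = 0 → ∀ x i, ∑ j, T x i j * f (x, j) = f (base (blk x), i))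
    {a : ℝ} (ha : 0 < a) (f : St × Cp → ℝ) (hf : f ≠ 0) :
    0 < ∑ p, f p * gLapCov src tgt c Rm blk W T a f p := by
  rw [qform_gLapCov]
  by_cases hD : covD src tgt c Rm f = 0
  · obtain ⟨q₀, hq₀⟩ := Function.ne_iff.mp (gMean_ne_zero blk hW hT base hf (hrep f hD))
    rw [hD]
    simp only [Pi.zero_apply, mul_zero, Finset.sum_const_zero, zero_add]
    exact mul_pos ha (lt_of_lt_of_le (mul_self_pos.mpr hq₀)
      (Finset.single_le_sum (f := fun q => gMean blk W T f q * gMean blk W T f q)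
        (fun q _ => mul_self_nonneg _) (mem_univ q₀)))
  · obtain ⟨b₀, hb₀⟩ := Function.ne_iff.mp hD
    exact add_pos_of_pos_of_nonneg
      (lt_of_lt_of_le (mul_self_pos.mpr hb₀)
        (Finset.single_le_sum (f := fun b => covD src tgt c Rm f b * covD src tgt c Rm f b)
          (fun b _ => mul_self_nonneg _) (mem_univ b₀)))
      (mul_nonneg ha.le (Finset.sum_nonneg fun q _ => mul_self_nonneg _))

/-- **Hence Δ_U + a·GᵀG is a unit** (finite dimension). [folklore] -/
theorem isUnit_gLapCov [DecidableEq Cp] (hW : ∀ x, 0 < W x) (hT : ∀ x i j, ∑ k, T x k i * T x k j = if i = j then (1 : ℝ) else 0)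
    (base : B → St)
    (hrep : ∀ f : St × Cp → ℝ, covD src tgt c Rm f = 0 → ∀ x i, ∑ j, T x i j * f (x, j) = f (base (blk x), i))
    {a : ℝ} (ha : 0 < a) : IsUnit (gLapCov src tgt c Rm blk W T a) :=
  isUnit_of_posDef (posDef_gLapCov src tgt c Rm blk W T hW hT base hrep ha)

/-- `Ring.inverse` of Δ_U + a·GᵀG is a genuine LEFT inverse. [folklore] -/
theorem inverse_mul_gLapCov [DecidableEq Cp] (hW : ∀ x, 0 < W x)
    (hT : ∀ x i j, ∑ k, T x k i * T x k j = if i = j then (1 : ℝ) else 0) (base : B → St)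
    (hrep : ∀ f : St × Cp → ℝ, covD src tgt c Rm f = 0 → ∀ x i, ∑ j, T x i j * f (x, j) = f (base (blk x), i))
    {a : ℝ} (ha : 0 < a) : Ring.inverse (gLapCov src tgt c Rm blk W T a) * gLapCov src tgt c Rm blk W T a = 1 :=
  inverse_mul_of_posDef (posDef_gLapCov src tgt c Rm blk W T hW hT base hrep ha)

/-- `Ring.inverse` of Δ_U + a·GᵀG is a genuine RIGHT inverse. [folklore] -/
theorem mul_inverse_gLapCov [DecidableEq Cp] (hW : ∀ x, 0 < W x)
    (hT : ∀ x i j, ∑ k, T x k i * T x k j = if i = j then (1 : ℝ) else 0) (base : B → St)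
    (hrep : ∀ f : St × Cp → ℝ, covD src tgt c Rm f = 0 → ∀ x i, ∑ j, T x i j * f (x, j) = f (base (blk x), i))
    {a : ℝ} (ha : 0 < a) : gLapCov src tgt c Rm blk W T a * Ring.inverse (gLapCov src tgt c Rm blk W T a) = 1 :=
  mul_inverse_of_posDef (posDef_gLapCov src tgt c Rm blk W T hW hT base hrep ha)

end Positivity

/-! ## §4  Two nested combs: the model of Q′(Ū)Q′(U) and the positivity of Δ_U + a·(Q₂Q₁)ᵀ(Q₂Q₁) -/

section TwoCombs

variable {St Bd B₁ B Cp : Type} [Fintype Cp] [DecidableEq Cp] {src tgt : Bd → St}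
  (K₁ : Comb src tgt B₁) (K : Comb src tgt B) (Rm : Bd → Cp → Cp → ℝ)

/-- **The coarse (second-level) covariant mean induced by a big comb K on the blocks of a fine comb K₁** (MODEL of
Q′(Ū) in (3.15)/(3.19), HONEST SCOPE (i)): a function on B₁ × Cp is summed over the small blocks β whose base point
lies in a given K-block, with weight W₂(β), after transport by K's holonomy `K.tr Rm (K₁.base β)` from the K-base
point to the K₁-base point. [cite: Balaban1985BackgroundPropagators, (3.15)+(3.19) p.393] -/
def coarseMean [Fintype B₁] [DecidableEq B] (W₂ : B₁ → ℝ) : (B₁ × Cp → ℝ) →ₗ[ℝ] (B × Cp → ℝ) :=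
  gMean (fun β => K.blk (K₁.base β)) W₂ (fun β => K.tr Rm (K₁.base β))

/-- MODEL: the explicit transpose of the coarse mean. [folklore] -/
def coarseMeanT (W₂ : B₁ → ℝ) : (B × Cp → ℝ) →ₗ[ℝ] (B₁ × Cp → ℝ) :=
  gMeanT (fun β => K.blk (K₁.base β)) W₂ (fun β => K.tr Rm (K₁.base β))

/-- `coarseMeanT` is the transpose of `coarseMean`. [folklore] -/
theorem isTransposePair_coarseMean [Fintype B₁] [Fintype B] [DecidableEq B] (W₂ : B₁ → ℝ) :
    IsTransposePair (coarseMean K₁ K Rm W₂) (coarseMeanT K₁ K Rm W₂) :=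
  isTransposePair_gMean _ _ _

/-- **THE TWO-LEVEL COMPOSITE Q₂Q₁ = Q′(Ū)Q′(U) in the model**: coarse mean after the comb mean of K₁ is the general
covariant block mean with blocks x ↦ K-block of the K₁-base point of the K₁-block of x, weights W₂(blk₁ x)·w₁(blk₁ x)
and transports (K.tr Rm (K₁-base point))·(K₁.tr Rm x) — the composite contour variable of locus (b) with the coarse
factor a holonomy of U itself. [cite: Balaban1985BackgroundPropagators, (3.15)+(3.19) p.393; Balaban1985Averaging, p.29] -/
theorem coarseMean_comp_covMean [Fintype St] [Fintype B₁] [DecidableEq B₁] [DecidableEq B] (W₂ : B₁ → ℝ)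
    (w₁ : B₁ → ℝ) :
    coarseMean K₁ K Rm W₂ ∘ₗ covMean K₁ w₁ Rm =
      gMean (fun x => K.blk (K₁.base (K₁.blk x))) (fun x => W₂ (K₁.blk x) * w₁ (K₁.blk x))
        (fun x => mmul (K.tr Rm (K₁.base (K₁.blk x))) (K₁.tr Rm x)) := by
  rw [coarseMean, covMean_eq_gMean, gMean_comp]
  rfl

/-- **Reproduction propagates through the two levels** (`Comb.tr_reproduces` twice + `mmul_reproduces`): for a
covariantly constant f (∇_U f = 0, all bond weights ≠ 0) the composite transport carries f(x) to the value of f at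
the K-base point of the K-block of the K₁-base point of x. [folklore] -/
theorem twoLevel_reproduces {c : Bd → ℝ} (hc : ∀ b, c b ≠ 0) {f : St × Cp → ℝ} (hD : covD src tgt c Rm f = 0) :
    ∀ x i, ∑ j, mmul (K.tr Rm (K₁.base (K₁.blk x))) (K₁.tr Rm x) i j * f (x, j) =
      f (K.base (K.blk (K₁.base (K₁.blk x))), i) :=
  fun x => mmul_reproduces (K₁.tr_reproduces Rm hc hD x) (K.tr_reproduces Rm hc hD (K₁.base (K₁.blk x)))

/-- **The composite transports are isometries** when every bond matrix is. [folklore] -/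
theorem twoLevel_orth (hRm : ∀ b i j, ∑ k, Rm b k i * Rm b k j = if i = j then (1 : ℝ) else 0) :
    ∀ x i j, ∑ k, mmul (K.tr Rm (K₁.base (K₁.blk x))) (K₁.tr Rm x) k i *
      mmul (K.tr Rm (K₁.base (K₁.blk x))) (K₁.tr Rm x) k j = if i = j then (1 : ℝ) else 0 :=
  fun x => mmul_orth (K.tr_orth Rm hRm _) (K₁.tr_orth Rm hRm x)

variable [Fintype St] [DecidableEq St] [Fintype B₁] [DecidableEq B₁] [Fintype B] [DecidableEq B]
  (c : Bd → ℝ) (w₁ : B₁ → ℝ) (W₂ : B₁ → ℝ)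

/-- **(Q₂Q₁)ᵀ composed out**: Q₁ᵀQ₂ᵀ equals the explicit transpose of the composite general mean (uniqueness of
transposes for the nondegenerate component pairing). [folklore] -/
theorem transpose_comp_eq_gMeanT :
    covMeanT K₁ w₁ Rm ∘ₗ coarseMeanT K₁ K Rm W₂ =
      gMeanT (fun x => K.blk (K₁.base (K₁.blk x))) (fun x => W₂ (K₁.blk x) * w₁ (K₁.blk x))
        (fun x => mmul (K.tr Rm (K₁.base (K₁.blk x))) (K₁.tr Rm x)) :=
  IsTransposePair.right_unique
    ((isTransposePair_covMean K₁ w₁ Rm).comp (isTransposePair_coarseMean K₁ K Rm W₂))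
    (by rw [coarseMean_comp_covMean]; exact isTransposePair_gMean _ _ _)

variable [Fintype Bd]

/-- **The two-level model of Δ′_a**: Δ_U + a·(Q₂Q₁)ᵀ(Q₂Q₁) with Q₁ = the comb mean of K₁ (weights w₁) and Q₂ = the
coarse mean of K on the K₁-blocks (weights W₂). [cite: Balaban1985BackgroundPropagators, (3.23)–(3.24) p.394 + (3.15)+(3.19) p.393] -/
def twoLevelOp (a : ℝ) : Module.End ℝ (St × Cp → ℝ) :=
  covDT src tgt c Rm ∘ₗ covD src tgt c Rm +
    a • ((covMeanT K₁ w₁ Rm ∘ₗ coarseMeanT K₁ K Rm W₂) ∘ₗ (coarseMean K₁ K Rm W₂ ∘ₗ covMean K₁ w₁ Rm))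

/-- **The two-level operator is a `gLapCov`** for the composite blocking, weights and transports. [folklore] -/
theorem twoLevelOp_eq_gLapCov (a : ℝ) :
    twoLevelOp K₁ K Rm c w₁ W₂ a =
      gLapCov src tgt c Rm (fun x => K.blk (K₁.base (K₁.blk x))) (fun x => W₂ (K₁.blk x) * w₁ (K₁.blk x))
        (fun x => mmul (K.tr Rm (K₁.base (K₁.blk x))) (K₁.tr Rm x)) a := by
  rw [twoLevelOp, gLapCov, transpose_comp_eq_gMeanT, coarseMean_comp_covMean]

/-- **MAIN THEOREM (MODEL, two levels). Δ_U + a·(Q₂Q₁)ᵀ(Q₂Q₁) is STRICTLY POSITIVE for EVERY isometric transport**,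
all bond weights ≠ 0, all block weights > 0, a > 0 — no nesting of the two combs, no flatness, no regularity of U.
[cite: Balaban1985BackgroundPropagators, p.395 + (3.23)–(3.24) p.394 + (3.15)+(3.19) p.393] -/
theorem posDef_twoLevelOp (hRm : ∀ b i j, ∑ k, Rm b k i * Rm b k j = if i = j then (1 : ℝ) else 0)
    (hc : ∀ b, c b ≠ 0) (hw₁ : ∀ β, 0 < w₁ β) (hW₂ : ∀ β, 0 < W₂ β) {a : ℝ} (ha : 0 < a) (f : St × Cp → ℝ)
    (hf : f ≠ 0) : 0 < ∑ p, f p * twoLevelOp K₁ K Rm c w₁ W₂ a f p := by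
  rw [twoLevelOp_eq_gLapCov]
  exact posDef_gLapCov src tgt c Rm _ _ _ (fun x => mul_pos (hW₂ _) (hw₁ _)) (twoLevel_orth K₁ K Rm hRm) K.base
    (fun f hD => twoLevel_reproduces K₁ K Rm hc hD) ha f hf

/-- **Hence Δ_U + a·(Q₂Q₁)ᵀ(Q₂Q₁) is a unit** for every isometric transport. [folklore] -/
theorem isUnit_twoLevelOp (hRm : ∀ b i j, ∑ k, Rm b k i * Rm b k j = if i = j then (1 : ℝ) else 0)
    (hc : ∀ b, c b ≠ 0) (hw₁ : ∀ β, 0 < w₁ β) (hW₂ : ∀ β, 0 < W₂ β) {a : ℝ} (ha : 0 < a) :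
    IsUnit (twoLevelOp K₁ K Rm c w₁ W₂ a) :=
  isUnit_of_posDef (posDef_twoLevelOp K₁ K Rm c w₁ W₂ hRm hc hw₁ hW₂ ha)

/-- `Ring.inverse` of the two-level operator is a genuine two-sided inverse (left). [folklore] -/
theorem inverse_mul_twoLevelOp (hRm : ∀ b i j, ∑ k, Rm b k i * Rm b k j = if i = j then (1 : ℝ) else 0)
    (hc : ∀ b, c b ≠ 0) (hw₁ : ∀ β, 0 < w₁ β) (hW₂ : ∀ β, 0 < W₂ β) {a : ℝ} (ha : 0 < a) :
    Ring.inverse (twoLevelOp K₁ K Rm c w₁ W₂ a) * twoLevelOp K₁ K Rm c w₁ W₂ a = 1 :=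
  inverse_mul_of_posDef (posDef_twoLevelOp K₁ K Rm c w₁ W₂ hRm hc hw₁ hW₂ ha)

/-- `Ring.inverse` of the two-level operator is a genuine two-sided inverse (right). [folklore] -/
theorem mul_inverse_twoLevelOp (hRm : ∀ b i j, ∑ k, Rm b k i * Rm b k j = if i = j then (1 : ℝ) else 0)
    (hc : ∀ b, c b ≠ 0) (hw₁ : ∀ β, 0 < w₁ β) (hW₂ : ∀ β, 0 < W₂ β) {a : ℝ} (ha : 0 < a) :
    twoLevelOp K₁ K Rm c w₁ W₂ a * Ring.inverse (twoLevelOp K₁ K Rm c w₁ W₂ a) = 1 :=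
  mul_inverse_of_posDef (posDef_twoLevelOp K₁ K Rm c w₁ W₂ hRm hc hw₁ hW₂ ha)

/-- **Symmetry of the two-level operator.** [folklore] -/
theorem isTransposePair_twoLevelOp (a : ℝ) :
    IsTransposePair (twoLevelOp K₁ K Rm c w₁ W₂ a) (twoLevelOp K₁ K Rm c w₁ W₂ a) := by
  rw [twoLevelOp_eq_gLapCov]
  exact isTransposePair_gLapCov src tgt c Rm _ _ _ a

end TwoCombs

/-! ## §5  The torus: nested cube blockings and the two-level operator of the lexicographic combs -/

section Torus

variable {d : ℕ} {N : Fin d → ℕ} [∀ i, NeZero (N i)]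

/-- **Nested cube blockings compose to the coarse cube blocking**: for M₀ ∣ M the M-block of the M₀-corner
`ctrU N M₀ (tblk … x)` of x is the M-block of x (⌊M₀⌊x_i/M₀⌋/M⌋ = ⌊x_i/M⌋). [folklore] -/
theorem tblk_ctrU_tblk {M₀ M : ℕ} (hM₀ : 1 ≤ M₀) (hdiv₀ : ∀ i, M₀ ∣ N i) (hM : 1 ≤ M) (hdiv : ∀ i, M ∣ N i)
    (hnest : M₀ ∣ M) (x : UT N) : tblk hM hdiv (ctrU N M₀ (tblk hM₀ hdiv₀ x)) = tblk hM hdiv x := by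
  obtain ⟨M₁, hM₁⟩ := hnest
  funext i
  apply Fin.ext
  rw [tblk_val, tblk_val]
  show M₀ * ((UT.toSite N x i).val / M₀) / M = (UT.toSite N x i).val / M
  rw [hM₁, ← Nat.div_div_eq_div_mul, ← Nat.div_div_eq_div_mul, Nat.mul_div_cancel_left _ hM₀]

variable [NeZero d]

/-- **For the lexicographic torus combs with nested cube sides M₀ ∣ M the composite blocking of §4 IS the M-cube
blocking.** [folklore] -/
theorem torusComb_twoLevel_blk {M₀ M : ℕ} (hM₀ : 1 ≤ M₀) (hdiv₀ : ∀ i, M₀ ∣ N i) (hM : 1 ≤ M)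
    (hdiv : ∀ i, M ∣ N i) (hnest : M₀ ∣ M) (x : UT N) :
    (torusComb hM hdiv).blk ((torusComb hM₀ hdiv₀).base ((torusComb hM₀ hdiv₀).blk x)) =
      (torusComb hM hdiv).blk x :=
  tblk_ctrU_tblk hM₀ hdiv₀ hM hdiv hnest x

/-- **Δ_U + a·(Q₂Q₁)ᵀ(Q₂Q₁) on the torus is a unit for EVERY isometric transport** — Q₁ the covariant mean over the
M₀-cubes along the lexicographic comb, Q₂ the coarse mean of the M-cube comb on the M₀-cubes; all bond weights ≠ 0,
block weights > 0, a > 0; 1 ≤ M₀, M₀ ∣ N_i, 1 ≤ M, M ∣ N_i (no nesting needed for the unit statement; with M₀ ∣ M the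
composite blocks are the M-cubes by `torusComb_twoLevel_blk`). [folklore] -/
theorem isUnit_twoLevelOp_torus {Cp : Type} [Fintype Cp] [DecidableEq Cp] {M₀ M : ℕ} (hM₀ : 1 ≤ M₀)
    (hdiv₀ : ∀ i, M₀ ∣ N i) (hM : 1 ≤ M) (hdiv : ∀ i, M ∣ N i) (c : UT N × Fin d → ℝ) (hc : ∀ b, c b ≠ 0)
    (w₁ : Ctr N M₀ → ℝ) (hw₁ : ∀ z, 0 < w₁ z) (W₂ : Ctr N M₀ → ℝ) (hW₂ : ∀ z, 0 < W₂ z)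
    (Rm : UT N × Fin d → Cp → Cp → ℝ) (hRm : ∀ b i j, ∑ k, Rm b k i * Rm b k j = if i = j then (1 : ℝ) else 0)
    {a : ℝ} (ha : 0 < a) : IsUnit (twoLevelOp (torusComb hM₀ hdiv₀) (torusComb hM hdiv) Rm c w₁ W₂ a) :=
  isUnit_twoLevelOp _ _ Rm c w₁ W₂ hRm hc hw₁ hW₂ ha

end Torus

/-! ## §6  Twins: the coupling a > 0 cannot be dropped, and the two-level operator on the twist witness -/

section Twins

variable {St Bd B₁ B Cp : Type} [Fintype Cp] [DecidableEq Cp] {src tgt : Bd → St}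
  (K₁ : Comb src tgt B₁) (K : Comb src tgt B) [Fintype St] [DecidableEq St] [Fintype B₁] [DecidableEq B₁]
  [DecidableEq B] [Fintype Bd]

/-- **NEGATIVE TWIN (the hypothesis a > 0 is used)**: at a = 0 the two-level operator is the bare covariant
Laplacian Δ_U, which for the trivial transport (every bond matrix the identity) kills the constant fields, so it is
NOT a unit (any combs, any weights; non-empty lattice and component set). [folklore] -/
theorem not_isUnit_twoLevelOp_zero [Nonempty St] [Nonempty Cp] (c : Bd → ℝ) (w₁ W₂ : B₁ → ℝ) :
    ¬ IsUnit (twoLevelOp K₁ K (fun (_ : Bd) (i j : Cp) => if i = j then (1 : ℝ) else 0) c w₁ W₂ 0) := by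
  have hf : (fun _ : St × Cp => (1 : ℝ)) ≠ 0 := by
    intro h
    obtain ⟨x⟩ := ‹Nonempty St›
    obtain ⟨i⟩ := ‹Nonempty Cp›
    exact one_ne_zero (congrFun h (x, i))
  have hD : covD src tgt c (fun (_ : Bd) (i j : Cp) => if i = j then (1 : ℝ) else 0)
      (fun _ : St × Cp => (1 : ℝ)) = 0 := by
    funext q
    rw [covD_apply, Pi.zero_apply, Finset.sum_eq_single q.2 (fun j _ hj => by rw [if_neg (Ne.symm hj), zero_mul])
      (fun h => absurd (mem_univ _) h), if_pos rfl]
    ring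
  refine not_isUnit_of_apply_eq_zero hf ?_
  rw [twoLevelOp, LinearMap.add_apply, LinearMap.comp_apply, hD, map_zero, zero_smul, LinearMap.zero_apply,
    add_zero]

/-- The one-block regime of the 8-point circle: 1 ≤ 8 and 8 ∣ 8. [folklore] -/
theorem hyps_N8_8 : (1 : ℕ) ≤ 8 ∧ ∀ i : Fin 1, 8 ∣ N8 i := ⟨by norm_num, fun _ => dvd_rfl⟩

/-- MODEL: the one-block comb (block side 8) of the 8-point circle — the coarse level above the two-block comb
`B9Thm37GlueTorusCov.comb8` (block side 4). [folklore] -/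
def comb8c : Comb (bsrc (N := N8)) (btgt (N := N8)) (Ctr N8 8) := torusComb hyps_N8_8.1 hyps_N8_8.2

/-- Nesting 4 ∣ 8 on the circle: the composite blocking of (comb8, comb8c) is the single 8-block. [folklore] -/
theorem comb8_twoLevel_blk (x : UT N8) : comb8c.blk (comb8.base (comb8.blk x)) = comb8c.blk x :=
  torusComb_twoLevel_blk lineage_hyps_N8.1 lineage_hyps_N8.2.1 hyps_N8_8.1 hyps_N8_8.2 ⟨2, rfl⟩ x

/-- **POSITIVE TWIN on the twist witness**: on the 8-point circle with the flat quarter-turn transport `Rm8` of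
`B9Thm37GlueTorusTwist` (where every U-independent block mean gives a NON-unit, `not_isUnit_twist8`), the two-level
operator Δ_U + a·(Q₂Q₁)ᵀ(Q₂Q₁) — Q₁ over the two 4-blocks, Q₂ over the one 8-block — IS a unit (all c(b) ≠ 0, block
weights > 0, a > 0). [folklore] -/
theorem isUnit_twoLevel_twist8 (c : UT N8 × Fin 1 → ℝ) (hc : ∀ b, c b ≠ 0) (w₁ : Ctr N8 4 → ℝ)
    (hw₁ : ∀ z, 0 < w₁ z) (W₂ : Ctr N8 4 → ℝ) (hW₂ : ∀ z, 0 < W₂ z) {a : ℝ} (ha : 0 < a) :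
    IsUnit (twoLevelOp comb8 comb8c Rm8 c w₁ W₂ a) :=
  isUnit_twoLevelOp comb8 comb8c Rm8 c w₁ W₂ hRm_Rm8 hc hw₁ hW₂ ha

end Twins

end Literature.MathematicalPhysics.QuantumFieldTheory.Balaban1983to89.B9Thm37GlueTorusCovComp
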